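import Summits.ABC.IUTFork.Repair.RHHullCellSliceLicence
import Summits.ABC.IUTFork.Cor312LicenceExactRadiusEnvelopeOrders
import HarnessLib

/-!
# D-0121 Q1 (T-OPTIMALITY), R33(4) at MIXED FIBRES — «credit ≤ shell budget + HEIGHT TRANSFER»: the cell slack of a GENERAL packet
# (several local types in one fibre over `p`) is at most `(1 + Σ_a (D_a + R_in,a − R_out,a)/e_a + (m_q/e_{b′} − μ))·log p`

PROOF-ONLY file (0 definitions, 0 `Prop` facts, no instance, no notation) of the abc-iut cell, rung LADDER-ABC:A2.RESCUE.H, seat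
abc-iut-rh2-T-1 (gen 4). SEQUEL, by name, of `Repair/RHCreditShellBudget.lean` (p491053, this seat gen 3: at the DIAGONAL packet of ONE field
`slack ≤ (|I|·(D + R_in − R_out)/e)·log p`, HEIGHT-FREE) and of abc-iut-rh-typ-4's `Repair/RHCellSlackExact.lean` (p481438), whose HONEST
SCOPE names what is done here: «on fibres with several local types the mixed tuples carry their own `m(e)` (content read at the tuple's
SHALLOWEST Θ-slot) and radii». The GLOBAL sum of R33(4) over the genuine setting's cells runs over ALL tuples `v⃗ = (v_a)_{a ∈ I}` of places
over `p` (p481438 §3 `cellSlack_settingPrVolSharp_eq`: `σ_{j,p} = Σ_{v⃗} Pr(v⃗)·(−m(v⃗)·log p + Σ_a log‖c^out(v_a)‖ − log‖t_{q,v_j}‖)`), not only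
over the diagonal ones; this file is the per-TUPLE kernel input at an ARBITRARY tuple.

SETTING (namespace `Summit.ABC.IUTFork.Repair.RHCreditShellBudgetMixed`). A general packet family `k : I → Type` of finite extensions of
`ℚ_p` (abc-iut-c312-5's `PacketAlgebra p k = ⊗_a k_a`, `normalizedPacket = (R_I)^∼`, `logPacket = log_p(R_I^×)`, `packetHull`, `indTwo` =
Dupuy–Hilado's full (Ind2), `packetLogμ = log μ̄`), per slot `a`: a norm uniformiser `ϖ_a` (`‖ϖ_a‖ = p^{−1/e_a}`), the different exponent `D_a`
(`d_a = D_a/e_a`), the inner radius `‖c_in,a‖ = ‖ϖ_a‖^{R_in,a}` (largest ball in `log_p(𝒪^×_{k_a})`), the outer radius `‖c_out,a‖ = ‖ϖ_a‖^{R_out,a}`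
(largest norm on `log_p(𝒪^×_{k_a})`), the Θ-slot scalar `x_a` with `‖x_a‖ = ‖ϖ_a‖^{M_a}`; the `q`-slot `b′` with `‖t_q‖ = ‖ϖ_{b′}‖^{m_q}`; the EXACT
CONTENT `m` of the slot union `⋃_a ι_a(x_a)·(R_I)^∼` as the binder pair `hm0`/`hm1` of p481438 §3 / abc-iut-w5-d180's
`Cor312Vol.packetLogμ_packetHull_orbit_slotUnion_eq` (in `p^m·log_p(R_I^×)`, not in `p^{m+1}·log_p(R_I^×)`).

WHAT IS TYPED.
* §1 `slotUnion_subset_zpow_smul_logPacket_of_le` — a CRUDE ADMISSIBLE CONTENT for a general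
  family: if `p^{m′}·‖x_a‖ ≤ p^{−d_I}·∏_i ‖c_in,i‖` at every slot `a` then `⋃_a ι_a(x_a)·(R_I)^∼ ⊆ p^{m′}·log_p(R_I^×)` (abc-iut-c312-5's EXACT content
  criterion `iota_smul_normalizedPacket_subset_zpow_smul_logPacket_iff` slot by slot, the family of conditions over the factor fields `L_J`
  discharged at once by `d_{L_J} ≥ 0`, abc-iut-S8's `differentOrd_nonneg`) · `le_content_of_subset` — an admissible `m′` is `≤` the exact content
  (maximality `hm1` + abc-iut-w5-d180's `zpow_smul_logPacket_anti`) · `slotUnion_subset_zpow_smul_logPacket_of_orders` — the orders form: `m′` is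
  admissible as soon as `m′ + Σ_i (D_i + R_in,i)/e_i ≤ M_a/e_a` for every slot `a`.
* §2 `cellSlack_eq_of_content` — the slack in orders at a general tuple: `log μ̄(hull(Ind2·⋃_a ι_a(x_a)·(R_I)^∼)) − log μ̄(ι_{b′}(t_q)·(R_I)^∼)
  = (−m − Σ_i R_out,i/e_i + m_q/e_{b′})·log p` (p481438's bracket, abc-iut-w5-d180 + abc-iut-c312-5 + Dupuy–Hilado (3.7)).
* §3 **`cellSlack_le_shellBudget_add_transfer`** — for ANY real `μ` with `μ ≤ M_a/e_a` at every slot (a common lower bound of the Θ-slot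
  valuations): **`slack ≤ (1 + Σ_i (D_i + R_in,i − R_out,i)/e_i + (m_q/e_{b′} − μ))·log p`**. The three terms: `1·log p` = the floor loss of the
  content (one per tuple); `Σ_i (D_i + G_i)/e_i`, `G = R_in − R_out ≥ 0` = different + log-shell span per slot (CONDUCTOR-type, as in p491053);
  `(m_q/e_{b′} − μ)` = the HEIGHT TRANSFER from the `q`-slot to the shallowest Θ-slot of the tuple.
  **`cellSlack_le_shellBudget_of_deep`** — if every Θ-slot is at least as deep as the `q`-slot (`m_q/e_{b′} ≤ M_a/e_a` for all `a`; automatic at a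
  DIAGONAL packet of the sharp setting, `M = j²·m_q ≥ m_q`) the transfer vanishes: `slack ≤ (1 + Σ_i (D_i + G_i)/e_i)·log p`, HEIGHT-FREE; and the
  CREDIT form **`cellCredit_le_shellBudget_of_deep`**: `max slack 0 ≤ (1 + Σ_i (D_i + G_i)/e_i)·log p` (`G_i ≥ 0` by abc-iut-rh2-w-2's
  `RH.HullCellSliceLicence.outerRadius_le_innerRadius`, `D_i ≥ 0`).
* §4 THE TRANSFER IS REAL (integer sanity, `decide`): two slots of ONE unramified type (`e = 1`, `D = 0`, `R_in = R_out = 1`, `p` odd), label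
  `j = 1` (`|I| = 2`, `M_a = m_{q,a}`), places `v₀, v₁` with `q`-orders `3 < 10`: the exact content of the tuple `(v₀, v₁)` is `min(3,10) − 2 = 1`
  and its slack is `10 − 1 − 2 = 7 = 10 − 3` (`= (h(v₁) − h(v₀))·log p`, HEIGHT-type credit), while the diagonal tuple `(v₁, v₁)` has content `8` and
  slack `0`. So R33(4) «the netting credit is conductor-type» (HOME/STATUS rh-lead g3 R38(b)) holds per DIAGONAL packet (p491053) and at every
  tuple meeting the deep-slot condition — in particular at every datum with ONE place over each bad prime — and NOT at a mixed fibre whose local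
  heights differ by a factor `> j²`: there the slack picks up the intra-fibre transfer `(h(v_{b′}) − j²·min_a h(v_a))⁺·log p`, Pr-weighted.

HONEST FRAMING: classical lattice arithmetic over the cell's REAL definitions at ONE tuple with prescribed integer data; the exact content
enters only through its defining binder pair; which genuine completion carries which `(e, D, R_in, R_out, M, m_q)` is the kit tables' audit
(computed ≠ proved), and the Pr-weighted sum over tuples / PN-sum over labels is NOT taken here. Nothing here decides any cell at genuine data,
asserts or denies [IUTchIII] Cor. 3.12, or bears on abc; no side taken on any author (Mochizuki / Scholze–Stix / Joshi / Dupuy–Hilado); typed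
≠ proved for anything not named as a theorem; instantiated ≠ endorsed. [claim: Mochizuki2012, status: disputed] for every quoted construction.
[cite: DupuyHilado2025, §3.6, §3.7, §4.9, §4.12] [cite: Mochizuki2012, IUTchIV Prop. 1.1 p. 9, Prop. 1.2 (i)(ii) p. 10, Prop. 1.4 (iii) p. 13–14,
Thm. 1.10 Step (v) p. 27–28] [cite: NeukirchANT1999, Ch. II (5.5)] [cite: WeilBNT1967, Ch. II §2, Th. 1–2]
-/

noncomputable section

open Set Function
open scoped Pointwise

namespace Summit.ABC.IUTFork.Repair.RHCreditShellBudgetMixed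

open Literature.IUT.LogVolume Literature.NumberTheory.GaloisRepresentations.Ultrametric Summit.ABC.IUTFork.Cor312Vol

variable (p : ℕ) [Fact p.Prime] {I : Type} [Fintype I] [DecidableEq I] [Nonempty I]
  (k : I → Type) [∀ i, NontriviallyNormedField (k i)] [∀ i, NormedAlgebra ℚ_[p] (k i)]
  [∀ i, IsUltrametricDist (k i)] [∀ i, ProperSpace (k i)]

/-! ## §1. A crude admissible content of the slot union of a general family, and the exact content from below -/



/-- **A crude admissible content for a GENERAL family.** With the largest inner balls `c_in,i·𝒪 ⊆ log_p(𝒪^×_{k_i})`: if at every slot `a`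
`p^{m′}·‖x_a‖ ≤ p^{−d_I}·∏_i ‖c_in,i‖`, then `⋃_a ι_a(x_a)·(R_I)^∼ ⊆ p^{m′}·log_p(R_I^×)` — abc-iut-c312-5's exact criterion
(`∀ J, p^{m′}·‖x_a‖ ≤ p^{−(d_I − d_{L_J})}·∏_i ‖c_in,i‖`) slot by slot, every factor-field condition discharged by `d_{L_J} ≥ 0`.
[cite: Mochizuki2012, IUTchIV Prop. 1.1 p. 9, Prop. 1.2 (ii) p. 10] [cite: DupuyHilado2025, §4.9, §4.12] -/
theorem slotUnion_subset_zpow_smul_logPacket_of_le {cin : Π i, k i} (hin0 : ∀ i, cin i ≠ 0)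
    (hin : ∀ i (o : k i), ‖o‖ ≤ 1 → cin i * o ∈ logUnits (k i))
    (hmax : ∀ i, ∃ (ϖ' : (k i)ˣ) (w : k i), IsUniformizer ϖ' ∧ w ∉ logUnits (k i) ∧ ‖w‖ * ‖(ϖ' : k i)‖ ≤ ‖cin i‖)
    (x : Π i, k i) {m' : ℤ} (hm' : ∀ a, (p : ℝ) ^ m' * ‖x a‖ ≤ (p : ℝ) ^ (-dSum p k) * ∏ i, ‖cin i‖) :
    (⋃ a, iota p k a (x a) • (normalizedPacket p k : Set (PacketAlgebra p k))) ⊆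
      ((p : ℚ_[p]) ^ m') • (logPacket p k : Set (PacketAlgebra p k)) := by
  refine Set.iUnion_subset fun a => ?_
  rw [iota_smul_normalizedPacket_subset_zpow_smul_logPacket_iff p k hin0 hin hmax a (x a) m']
  intro J
  refine (hm' a).trans (mul_le_mul_of_nonneg_right ?_ (Finset.prod_nonneg fun i _ => norm_nonneg _))
  have hp1 : (1 : ℝ) ≤ p := by exact_mod_cast (Fact.out : p.Prime).one_lt.le
  exact Real.rpow_le_rpow_of_exponent_le hp1 (by linarith [differentOrd_nonneg p (DFac p k J)])


/-- **An admissible content is at most the exact content**: if the slot union is NOT in `p^{m+1}·log_p(R_I^×)` (maximality half of the exact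
content) and IS in `p^{m′}·log_p(R_I^×)`, then `m′ ≤ m` (`p^{m′}·log_p(R_I^×) ⊆ p^{m+1}·log_p(R_I^×)` for `m + 1 ≤ m′`, abc-iut-w5-d180's
`zpow_smul_logPacket_anti`). [cite: WeilBNT1967, Ch. II §2, Th. 2] -/
theorem le_content_of_subset {x : Π i, k i} {m m' : ℤ}
    (hm1 : ¬ (⋃ a, iota p k a (x a) • (normalizedPacket p k : Set (PacketAlgebra p k))) ⊆
      ((p : ℚ_[p]) ^ (m + 1)) • (logPacket p k : Set (PacketAlgebra p k)))
    (hm' : (⋃ a, iota p k a (x a) • (normalizedPacket p k : Set (PacketAlgebra p k))) ⊆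
      ((p : ℚ_[p]) ^ m') • (logPacket p k : Set (PacketAlgebra p k))) : m' ≤ m := by
  by_contra h
  push Not at h
  exact hm1 (hm'.trans (zpow_smul_logPacket_anti p k (show m + 1 ≤ m' by omega)))


/-- **Orders form of the crude admissible content.** Norm uniformisers `ϖ_i`, different exponents `D_i` (`d_i = D_i/e_i`), inner radii
`‖c_in,i‖ = ‖ϖ_i‖^{R_in,i}`, Θ-slot scalars `‖x_a‖ = ‖ϖ_a‖^{M_a}`: if `m′ + Σ_i (D_i + R_in,i)/e_i ≤ M_a/e_a` at every slot `a`, then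
`⋃_a ι_a(x_a)·(R_I)^∼ ⊆ p^{m′}·log_p(R_I^×)`. [cite: Mochizuki2012, IUTchIV Prop. 1.2 (ii) p. 10] [cite: NeukirchANT1999, Ch. II (5.5)] -/
theorem slotUnion_subset_zpow_smul_logPacket_of_orders (ϖ : Π i, (k i)ˣ) (hϖ : ∀ i, IsUniformizer (ϖ i))
    {D : I → ℕ} (hD : ∀ i, differentOrd p (k i) = (D i : ℝ) / absRamificationIdx p (k i))
    {cin : Π i, k i} (hin : ∀ i (o : k i), ‖o‖ ≤ 1 → cin i * o ∈ logUnits (k i))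
    (hmax : ∀ i, ∃ (ϖ' : (k i)ˣ) (w : k i), IsUniformizer ϖ' ∧ w ∉ logUnits (k i) ∧ ‖w‖ * ‖(ϖ' : k i)‖ ≤ ‖cin i‖)
    {Rin : I → ℤ} (hRin : ∀ i, ‖cin i‖ = ‖(ϖ i : k i)‖ ^ Rin i)
    {x : Π i, k i} {M : I → ℤ} (hx : ∀ a, ‖x a‖ = ‖(ϖ a : k a)‖ ^ M a) {m' : ℤ}
    (hm' : ∀ a, (m' : ℝ) + ∑ i, ((D i : ℝ) + Rin i) / absRamificationIdx p (k i) ≤ (M a : ℝ) / absRamificationIdx p (k a)) :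
    (⋃ a, iota p k a (x a) • (normalizedPacket p k : Set (PacketAlgebra p k))) ⊆
      ((p : ℚ_[p]) ^ m') • (logPacket p k : Set (PacketAlgebra p k)) := by
  have hp : p.Prime := Fact.out
  have hp1 : (1 : ℝ) < p := by exact_mod_cast hp.one_lt
  have hp0 : (0 : ℝ) < p := by linarith
  have hin0 : ∀ i, cin i ≠ 0 := fun i => by
    rw [← norm_pos_iff, hRin i]; exact zpow_pos (norm_pos_iff.2 (ϖ i).ne_zero) _
  refine slotUnion_subset_zpow_smul_logPacket_of_le p k hin0 hin hmax x fun a => ?_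
  -- everything is a power of `p`
  have hdSum : dSum p k = ∑ i, (D i : ℝ) / absRamificationIdx p (k i) := by
    rw [dSum]; exact Finset.sum_congr rfl fun i _ => hD i
  have hprod : ∏ i, ‖cin i‖ = (p : ℝ) ^ (-∑ i, (Rin i : ℝ) / absRamificationIdx p (k i)) := by
    rw [← Finset.sum_neg_distrib, Real.rpow_sum_of_pos hp0]
    exact Finset.prod_congr rfl fun i _ => by rw [hRin i, Thm311.Real.norm_unif_zpow_eq_rpow p (hϖ i)]
  rw [hx a, Thm311.Real.norm_unif_zpow_eq_rpow p (hϖ a), hprod, hdSum, ← Real.rpow_intCast, ← Real.rpow_add hp0,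
    ← Real.rpow_add hp0, Real.rpow_le_rpow_left_iff hp1]
  have hsum : ∑ i, ((D i : ℝ) + Rin i) / absRamificationIdx p (k i) =
      ∑ i, (D i : ℝ) / absRamificationIdx p (k i) + ∑ i, (Rin i : ℝ) / absRamificationIdx p (k i) := by
    rw [← Finset.sum_add_distrib]
    exact Finset.sum_congr rfl fun i _ => by rw [add_div]
  have h := hm' a
  rw [hsum] at h
  linarith

/-! ## §2. The slack of a general tuple in orders -/


/-- **THE SLACK OF A GENERAL TUPLE IN ORDERS.** With the exact content `m` of the slot union (binders `hm0`/`hm1`), outer radii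
`‖c_out,i‖ = ‖ϖ_i‖^{R_out,i}` (largest norms on the `log_p(𝒪^×_{k_i})`) and `‖t_q‖ = ‖ϖ_{b′}‖^{m_q}`:
`log μ̄(hull(⋃_{g∈Ind2} g·⋃_a ι_a(x_a)·(R_I)^∼)) − log μ̄(ι_{b′}(t_q)·(R_I)^∼) = (−m − Σ_i R_out,i/e_i + m_q/e_{b′})·log p` — p481438's bracket
`−m·log p + Σ_a log‖c^out_a‖ − log‖t_q‖` at a tuple of ANY local types (abc-iut-w5-d180 `packetLogμ_packetHull_orbit_slotUnion_eq` +
abc-iut-c312-5 `packetLogμ_packetHull_logPacket_eq_sum` + Dupuy–Hilado (3.7) `packetLogμ_iota_smul_normalizedPacket`).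
[cite: DupuyHilado2025, §3.7, §4.9, §4.12] [cite: Mochizuki2012, IUTchIV Prop. 1.4 (iii) p. 13–14] [claim: Mochizuki2012, status: disputed] -/
theorem cellSlack_eq_of_content (ϖ : Π i, (k i)ˣ) (hϖ : ∀ i, IsUniformizer (ϖ i)) {cout : Π i, k i}
    (houtΛ : ∀ i, cout i ∈ logUnits (k i)) (hdom : ∀ i, ∀ z ∈ logUnits (k i), ‖z‖ ≤ ‖cout i‖)
    {Rout : I → ℤ} (hRout : ∀ i, ‖cout i‖ = ‖(ϖ i : k i)‖ ^ Rout i) {x : Π i, k i} {m : ℤ}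
    (hm0 : (⋃ a, iota p k a (x a) • (normalizedPacket p k : Set (PacketAlgebra p k))) ⊆
      ((p : ℚ_[p]) ^ m) • (logPacket p k : Set (PacketAlgebra p k)))
    (hm1 : ¬ (⋃ a, iota p k a (x a) • (normalizedPacket p k : Set (PacketAlgebra p k))) ⊆
      ((p : ℚ_[p]) ^ (m + 1)) • (logPacket p k : Set (PacketAlgebra p k)))
    (b' : I) {tq : k b'} {mq : ℤ} (hq : ‖tq‖ = ‖(ϖ b' : k b')‖ ^ mq) :
    packetLogμ p k (packetHull p k (⋃ g : indTwo p k,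
          g • ⋃ a, iota p k a (x a) • (normalizedPacket p k : Set (PacketAlgebra p k)))) -
        packetLogμ p k (iota p k b' tq • (normalizedPacket p k : Set (PacketAlgebra p k))) =
      (-(m : ℝ) - ∑ i, (Rout i : ℝ) / absRamificationIdx p (k i) + (mq : ℝ) / absRamificationIdx p (k b')) * Real.log p := by
  have hp0 : (0 : ℝ) < p := by exact_mod_cast (Fact.out : p.Prime).pos
  have htq0 : tq ≠ 0 := by
    rw [← norm_pos_iff, hq]; exact zpow_pos (norm_pos_iff.2 (ϖ b').ne_zero) _
  rw [packetLogμ_packetHull_orbit_slotUnion_eq p k x hm0 hm1,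
    packetLogμ_packetHull_logPacket_eq_sum p k (z := cout) houtΛ hdom, packetLogμ_iota_smul_normalizedPacket p k b' htq0, hq,
    Thm311.Real.norm_unif_zpow_eq_rpow p (hϖ b'), Real.log_rpow hp0]
  have hlog : ∀ i, Real.log ‖cout i‖ = -((Rout i : ℝ) / absRamificationIdx p (k i)) * Real.log p := fun i => by
    rw [hRout i, Thm311.Real.norm_unif_zpow_eq_rpow p (hϖ i), Real.log_rpow hp0]
  rw [Finset.sum_congr rfl fun i _ => hlog i, ← Finset.sum_mul, Finset.sum_neg_distrib]
  ring

/-! ## §3. The slack against the shell budget plus the height transfer -/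


/-- **`slack ≤ shell budget + HEIGHT TRANSFER` AT A GENERAL TUPLE.** Per slot `i`: `e_i`, `D_i`, `R_in,i`, `R_out,i` as above, Θ-depths
`‖x_a‖ = ‖ϖ_a‖^{M_a}`, `q`-slot `b′` of depth `m_q`, exact content binders `hm0`/`hm1`. For ANY real `μ ≤ M_a/e_a` (all `a`):
`log μ̄(hull(Ind2·⋃_a ι_a(x_a)·(R_I)^∼)) − log μ̄(ι_{b′}(t_q)·(R_I)^∼) ≤ (1 + Σ_i (D_i + (R_in,i − R_out,i))/e_i + (m_q/e_{b′} − μ))·log p`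
(§1: `⌊μ − Σ_i (D_i + R_in,i)/e_i⌋` is admissible, hence `≤ m`; §2). The last term is the transfer from the `q`-slot to the shallowest
Θ-slot; it is `≤ 0` iff every Θ-slot is at least as deep as the `q`-slot. [cite: DupuyHilado2025, §4.9, §4.12]
[cite: Mochizuki2012, IUTchIV Prop. 1.2 (i)(ii) p. 10, Prop. 1.4 (iii) p. 13–14] [claim: Mochizuki2012, status: disputed] -/
theorem cellSlack_le_shellBudget_add_transfer (ϖ : Π i, (k i)ˣ) (hϖ : ∀ i, IsUniformizer (ϖ i))
    {D : I → ℕ} (hD : ∀ i, differentOrd p (k i) = (D i : ℝ) / absRamificationIdx p (k i))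
    {cin cout : Π i, k i} (hin : ∀ i (o : k i), ‖o‖ ≤ 1 → cin i * o ∈ logUnits (k i))
    (hmax : ∀ i, ∃ (ϖ' : (k i)ˣ) (w : k i), IsUniformizer ϖ' ∧ w ∉ logUnits (k i) ∧ ‖w‖ * ‖(ϖ' : k i)‖ ≤ ‖cin i‖)
    (houtΛ : ∀ i, cout i ∈ logUnits (k i)) (hdom : ∀ i, ∀ z ∈ logUnits (k i), ‖z‖ ≤ ‖cout i‖)
    {Rin Rout : I → ℤ} (hRin : ∀ i, ‖cin i‖ = ‖(ϖ i : k i)‖ ^ Rin i) (hRout : ∀ i, ‖cout i‖ = ‖(ϖ i : k i)‖ ^ Rout i)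
    {x : Π i, k i} {M : I → ℤ} (hx : ∀ a, ‖x a‖ = ‖(ϖ a : k a)‖ ^ M a) {m : ℤ}
    (hm0 : (⋃ a, iota p k a (x a) • (normalizedPacket p k : Set (PacketAlgebra p k))) ⊆
      ((p : ℚ_[p]) ^ m) • (logPacket p k : Set (PacketAlgebra p k)))
    (hm1 : ¬ (⋃ a, iota p k a (x a) • (normalizedPacket p k : Set (PacketAlgebra p k))) ⊆
      ((p : ℚ_[p]) ^ (m + 1)) • (logPacket p k : Set (PacketAlgebra p k)))
    (b' : I) {tq : k b'} {mq : ℤ} (hq : ‖tq‖ = ‖(ϖ b' : k b')‖ ^ mq)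
    {μ : ℝ} (hμ : ∀ a, μ ≤ (M a : ℝ) / absRamificationIdx p (k a)) :
    packetLogμ p k (packetHull p k (⋃ g : indTwo p k,
          g • ⋃ a, iota p k a (x a) • (normalizedPacket p k : Set (PacketAlgebra p k)))) -
        packetLogμ p k (iota p k b' tq • (normalizedPacket p k : Set (PacketAlgebra p k))) ≤
      (1 + ∑ i, ((D i : ℝ) + (Rin i - Rout i)) / absRamificationIdx p (k i) +
          ((mq : ℝ) / absRamificationIdx p (k b') - μ)) * Real.log p := by
  have hp1 : (1 : ℝ) < p := by exact_mod_cast (Fact.out : p.Prime).one_lt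
  have hlog : 0 < Real.log p := Real.log_pos hp1
  -- the crude admissible content `⌊μ − Σ (D + R_in)/e⌋` is `≤ m`
  set S : ℝ := ∑ i, ((D i : ℝ) + Rin i) / absRamificationIdx p (k i) with hS
  have hadm := slotUnion_subset_zpow_smul_logPacket_of_orders p k ϖ hϖ hD hin hmax hRin hx (m' := ⌊μ - S⌋) fun a => by
    have h1 : ((⌊μ - S⌋ : ℤ) : ℝ) ≤ μ - S := Int.floor_le _
    linarith [hμ a]
  have hle : ⌊μ - S⌋ ≤ m := le_content_of_subset p k hm1 hadm
  have hm_lb : μ - S - 1 < (m : ℝ) := by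
    have h1 : μ - S < ((⌊μ - S⌋ : ℤ) : ℝ) + 1 := Int.lt_floor_add_one _
    have h2 : ((⌊μ - S⌋ : ℤ) : ℝ) ≤ (m : ℝ) := by exact_mod_cast hle
    linarith
  rw [cellSlack_eq_of_content p k ϖ hϖ houtΛ hdom hRout hm0 hm1 b' hq]
  refine mul_le_mul_of_nonneg_right ?_ hlog.le
  have hsplit : ∑ i, ((D i : ℝ) + (Rin i - Rout i)) / absRamificationIdx p (k i) =
      S - ∑ i, (Rout i : ℝ) / absRamificationIdx p (k i) := by
    rw [hS, ← Finset.sum_sub_distrib]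
    exact Finset.sum_congr rfl fun i _ => by ring
  rw [hsplit]
  linarith


/-- **`slack ≤ shell budget` WHEN EVERY Θ-SLOT IS AT LEAST AS DEEP AS THE `q`-SLOT** (`m_q/e_{b′} ≤ M_a/e_a` for all `a` — automatic at a
DIAGONAL packet of the sharp setting, `M = j²·m_q`, `m_q ≥ 0`): `slack ≤ (1 + Σ_i (D_i + (R_in,i − R_out,i))/e_i)·log p` — the different plus the
log-shell span per slot plus one floor loss, HEIGHT-FREE (no `M_a`, no `m_q`). D-0121 R33(4) «the credit is conductor-type» at a tuple of
several local types. [cite: DupuyHilado2025, §4.12] [cite: Mochizuki2012, IUTchIV Prop. 1.2 (i)(ii) p. 10] [claim: Mochizuki2012, status: disputed] -/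
theorem cellSlack_le_shellBudget_of_deep (ϖ : Π i, (k i)ˣ) (hϖ : ∀ i, IsUniformizer (ϖ i))
    {D : I → ℕ} (hD : ∀ i, differentOrd p (k i) = (D i : ℝ) / absRamificationIdx p (k i))
    {cin cout : Π i, k i} (hin : ∀ i (o : k i), ‖o‖ ≤ 1 → cin i * o ∈ logUnits (k i))
    (hmax : ∀ i, ∃ (ϖ' : (k i)ˣ) (w : k i), IsUniformizer ϖ' ∧ w ∉ logUnits (k i) ∧ ‖w‖ * ‖(ϖ' : k i)‖ ≤ ‖cin i‖)
    (houtΛ : ∀ i, cout i ∈ logUnits (k i)) (hdom : ∀ i, ∀ z ∈ logUnits (k i), ‖z‖ ≤ ‖cout i‖)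
    {Rin Rout : I → ℤ} (hRin : ∀ i, ‖cin i‖ = ‖(ϖ i : k i)‖ ^ Rin i) (hRout : ∀ i, ‖cout i‖ = ‖(ϖ i : k i)‖ ^ Rout i)
    {x : Π i, k i} {M : I → ℤ} (hx : ∀ a, ‖x a‖ = ‖(ϖ a : k a)‖ ^ M a) {m : ℤ}
    (hm0 : (⋃ a, iota p k a (x a) • (normalizedPacket p k : Set (PacketAlgebra p k))) ⊆
      ((p : ℚ_[p]) ^ m) • (logPacket p k : Set (PacketAlgebra p k)))
    (hm1 : ¬ (⋃ a, iota p k a (x a) • (normalizedPacket p k : Set (PacketAlgebra p k))) ⊆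
      ((p : ℚ_[p]) ^ (m + 1)) • (logPacket p k : Set (PacketAlgebra p k)))
    (b' : I) {tq : k b'} {mq : ℤ} (hq : ‖tq‖ = ‖(ϖ b' : k b')‖ ^ mq)
    (hdeep : ∀ a, (mq : ℝ) / absRamificationIdx p (k b') ≤ (M a : ℝ) / absRamificationIdx p (k a)) :
    packetLogμ p k (packetHull p k (⋃ g : indTwo p k,
          g • ⋃ a, iota p k a (x a) • (normalizedPacket p k : Set (PacketAlgebra p k)))) -
        packetLogμ p k (iota p k b' tq • (normalizedPacket p k : Set (PacketAlgebra p k))) ≤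
      (1 + ∑ i, ((D i : ℝ) + (Rin i - Rout i)) / absRamificationIdx p (k i)) * Real.log p := by
  have h := cellSlack_le_shellBudget_add_transfer p k ϖ hϖ hD hin hmax houtΛ hdom hRin hRout hx hm0 hm1 b' hq hdeep
  rwa [sub_self, add_zero] at h


/-- **THE CREDIT FORM**: under the deep-slot condition the netting credit of the tuple, `max slack 0`, is at most
`(1 + Σ_i (D_i + (R_in,i − R_out,i))/e_i)·log p`, which is `≥ 0` (`R_out,i ≤ R_in,i`: the inner ball lies in the shell,
abc-iut-rh2-w-2's `RH.HullCellSliceLicence.outerRadius_le_innerRadius`; `D_i ≥ 0`). [cite: DupuyHilado2025, §4.12] [claim: Mochizuki2012, status: disputed] -/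
theorem cellCredit_le_shellBudget_of_deep (ϖ : Π i, (k i)ˣ) (hϖ : ∀ i, IsUniformizer (ϖ i))
    {D : I → ℕ} (hD : ∀ i, differentOrd p (k i) = (D i : ℝ) / absRamificationIdx p (k i))
    {cin cout : Π i, k i} (hin : ∀ i (o : k i), ‖o‖ ≤ 1 → cin i * o ∈ logUnits (k i))
    (hmax : ∀ i, ∃ (ϖ' : (k i)ˣ) (w : k i), IsUniformizer ϖ' ∧ w ∉ logUnits (k i) ∧ ‖w‖ * ‖(ϖ' : k i)‖ ≤ ‖cin i‖)
    (houtΛ : ∀ i, cout i ∈ logUnits (k i)) (hdom : ∀ i, ∀ z ∈ logUnits (k i), ‖z‖ ≤ ‖cout i‖)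
    {Rin Rout : I → ℤ} (hRin : ∀ i, ‖cin i‖ = ‖(ϖ i : k i)‖ ^ Rin i) (hRout : ∀ i, ‖cout i‖ = ‖(ϖ i : k i)‖ ^ Rout i)
    {x : Π i, k i} {M : I → ℤ} (hx : ∀ a, ‖x a‖ = ‖(ϖ a : k a)‖ ^ M a) {m : ℤ}
    (hm0 : (⋃ a, iota p k a (x a) • (normalizedPacket p k : Set (PacketAlgebra p k))) ⊆
      ((p : ℚ_[p]) ^ m) • (logPacket p k : Set (PacketAlgebra p k)))
    (hm1 : ¬ (⋃ a, iota p k a (x a) • (normalizedPacket p k : Set (PacketAlgebra p k))) ⊆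
      ((p : ℚ_[p]) ^ (m + 1)) • (logPacket p k : Set (PacketAlgebra p k)))
    (b' : I) {tq : k b'} {mq : ℤ} (hq : ‖tq‖ = ‖(ϖ b' : k b')‖ ^ mq)
    (hdeep : ∀ a, (mq : ℝ) / absRamificationIdx p (k b') ≤ (M a : ℝ) / absRamificationIdx p (k a)) :
    max (packetLogμ p k (packetHull p k (⋃ g : indTwo p k,
          g • ⋃ a, iota p k a (x a) • (normalizedPacket p k : Set (PacketAlgebra p k)))) -
        packetLogμ p k (iota p k b' tq • (normalizedPacket p k : Set (PacketAlgebra p k)))) 0 ≤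
      (1 + ∑ i, ((D i : ℝ) + (Rin i - Rout i)) / absRamificationIdx p (k i)) * Real.log p := by
  refine max_le (cellSlack_le_shellBudget_of_deep p k ϖ hϖ hD hin hmax houtΛ hdom hRin hRout hx hm0 hm1 b' hq hdeep) ?_
  have hp1 : (1 : ℝ) < p := by exact_mod_cast (Fact.out : p.Prime).one_lt
  have hlog : 0 < Real.log p := Real.log_pos hp1
  refine mul_nonneg (add_nonneg zero_le_one (Finset.sum_nonneg fun i _ => div_nonneg ?_ ?_)) hlog.le
  · have hG : Rout i ≤ Rin i := RH.HullCellSliceLicence.outerRadius_le_innerRadius (hϖ i) (hin i) (hdom i) (hRin i) (hRout i)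
    have hG' : (Rout i : ℝ) ≤ Rin i := by exact_mod_cast hG
    have hD0 : (0 : ℝ) ≤ D i := Nat.cast_nonneg _
    linarith
  · exact_mod_cast (Nat.zero_le _)

/-! ## §4. The transfer is real: two slots of one unramified type, label `j = 1` -/

/-- Integer sanity (numbers, not adjectives). One unramified odd type: `e = 1`, `D = 0`, `R_in = R_out = 1` (`log_p(𝒪^×) = p𝒪`); label
`j = 1` so `|I| = 2` and the Θ-depth at a place equals its `q`-depth; two places with `q`-orders `3 < 10`, `q`-slot at the deeper one.
The exact content of a slot union is `min_a M_a − (|I|−1)·D − |I|·R_in` and the slack is `m_q − e·(content) − |I|·R_out` (in units of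
`(log p)/e`, p483291 `cellSlack_diag_orders` slot by slot): the MIXED tuple `(3, 10)` has content `1` and slack `7 = 10 − 3` (the full height
difference — HEIGHT-type), the DIAGONAL tuple `(10, 10)` has content `8` and slack `0`; §3's bound at `μ = 3` reads `1 + 0 + (10 − 3) = 8 ≥ 7`. -/
example : min (3 : ℤ) 10 - (2 - 1) * 0 - 2 * 1 = 1 ∧ (10 : ℤ) - 1 * 1 - 2 * 1 = 7 ∧
    min (10 : ℤ) 10 - (2 - 1) * 0 - 2 * 1 = 8 ∧ (10 : ℤ) - 1 * 8 - 2 * 1 = 0 ∧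
    (7 : ℤ) ≤ 1 + 2 * (0 + (1 - 1)) + (10 - 3) := by decide

end Summit.ABC.IUTFork.Repair.RHCreditShellBudgetMixed

end
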